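import Summits.ValiantsHypothesis.ValiantsHypothesis.Theorems.KPlusLogSqLawTropicalBMarkedEdgeCoreQLaw

/-!
# Route «KPlusLogSqLaw», crux `TropicalB` (stmt-ValiantsHypothesis-19771) — MARKED-EDGE sector, NESTED-TRIANGLE CORE, ALL sizes:
# the law MODULO THE P-COMPLETION — `nestedTriangle_false_of_pcD`

HONEST FRAMING.  Helper file (cell `pub-symmetroid`, seat val-sym-trop-p4 (g19), 2026-08-29; `--supports stmt-ValiantsHypothesis-19771 --as
helper`).  States the EXACT residual of the all-m nested-triangle law after this seat's `core_S3` (p680388) and `law_of_pcD_BC/BE` (p681550) as two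
explicit hypotheses — the P-completions PC-D(B,C) and PC-D(B,E): «every Q₁₈ (resp. Q₂₀) cover extends to a factorisation of `σB⊎σC⊎σC⊎σZ`
(resp. `σB⊎σE⊎σE⊎σZ`) whose other three slopes satisfy `9 ≤ s(N₃)`, `19 ≤ s(N₂)+s(N₃)` (resp. `21 ≤ …`)» — and proves: in any realisation of
the core {1,2},{1,3},{2,3},{0,4} satisfying them, `False`.  PC-D is LOCATED (memo S3STAR-PROOF-g19 §5: 0 exceptions in > 250 000 kernel-valid
relative systems, m ≤ 9, and on g18's corpora) and OPEN.  So this file does NOT prove the law; it names what is left.  Nothing concerns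
`TropicalB` in its window, `WeakLifting`, the doors, `MatrixDescartes` (stmt-ValiantsHypothesis-18050) or VP ≠ VNP.
-/

set_option linter.dupNamespace false
set_option autoImplicit false

namespace Summit.ValiantsHypothesis.ValiantsHypothesis.Theorems.KPlusLogSqLaw
namespace MarkedEdge
namespace Core

open Finset

variable {V : Type*} [Fintype V] [DecidableEq V]

section Core

variable (ok : V → V → Prop) (w g : V → V → ℤ) (b : Fin 5 → V)

/-- **The all-m nested-triangle law modulo the P-completion.**  In the Core files' setting: if every cover `Q` inside `σB⊎σC⊎σZ` with marked
fixed points exactly {b1,b4} extends to a `σB⊎σC⊎σC⊎σZ`-factorisation `(N₁,N₂,N₃,Q)` with `9 ≤ s(N₃)` and `19 ≤ s(N₂)+s(N₃)` (PC-D(B,C)), and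
every cover inside `σB⊎σE⊎σZ` with marked fixed points exactly {b2,b4} extends to a `σB⊎σE⊎σE⊎σZ`-factorisation with `9 ≤ s(N₃)`,
`21 ≤ s(N₂)+s(N₃)` (PC-D(B,E)), then the core {1,2},{1,3},{2,3},{0,4} has NO realisation on `V`. [this seat's theorem; PC-D itself is open] -/
theorem nestedTriangle_false_of_pcD (hb : Function.Injective b)
    (hoff : ∀ i j, j ≠ i → g i j = 0) (hmark : ∀ l, g (b l) (b l) = (2 : ℤ) ^ (l : ℕ)) (haux : ∀ i, (∀ l, b l ≠ i) → g i i = 0)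
    {θB θC θE θZ : ℤ} {σB σC σE σZ : Equiv.Perm V}
    (hB : (∀ i, ok i (σB i)) ∧ ∀ τ : Equiv.Perm V, τ ≠ σB → (∀ i, ok i (τ i)) →
      ∑ i, (w i (τ i) + θB * g i (τ i)) < ∑ i, (w i (σB i) + θB * g i (σB i)))
    (hC : (∀ i, ok i (σC i)) ∧ ∀ τ : Equiv.Perm V, τ ≠ σC → (∀ i, ok i (τ i)) →
      ∑ i, (w i (τ i) + θC * g i (τ i)) < ∑ i, (w i (σC i) + θC * g i (σC i)))
    (hE : (∀ i, ok i (σE i)) ∧ ∀ τ : Equiv.Perm V, τ ≠ σE → (∀ i, ok i (τ i)) →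
      ∑ i, (w i (τ i) + θE * g i (τ i)) < ∑ i, (w i (σE i) + θE * g i (σE i)))
    (hZ : (∀ i, ok i (σZ i)) ∧ ∀ τ : Equiv.Perm V, τ ≠ σZ → (∀ i, ok i (τ i)) →
      ∑ i, (w i (τ i) + θZ * g i (τ i)) < ∑ i, (w i (σZ i) + θZ * g i (σZ i)))
    (hB0 : σB (b 0) ≠ b 0) (hB1 : σB (b 1) = b 1) (hB2 : σB (b 2) = b 2) (hB3 : σB (b 3) ≠ b 3) (hB4 : σB (b 4) ≠ b 4)
    (hC0 : σC (b 0) ≠ b 0) (hC1 : σC (b 1) = b 1) (hC2 : σC (b 2) ≠ b 2) (hC3 : σC (b 3) = b 3) (hC4 : σC (b 4) ≠ b 4)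
    (hE0 : σE (b 0) ≠ b 0) (hE1 : σE (b 1) ≠ b 1) (hE2 : σE (b 2) = b 2) (hE3 : σE (b 3) = b 3) (hE4 : σE (b 4) ≠ b 4)
    (hZ0 : σZ (b 0) = b 0) (hZ1 : σZ (b 1) ≠ b 1) (hZ2 : σZ (b 2) ≠ b 2) (hZ3 : σZ (b 3) ≠ b 3) (hZ4 : σZ (b 4) = b 4)
    (hPC_BC : ∀ Q : Equiv.Perm V, (∀ i, Q i = σB i ∨ Q i = σC i ∨ Q i = σZ i) →
      Q (b 0) ≠ b 0 → Q (b 1) = b 1 → Q (b 2) ≠ b 2 → Q (b 3) ≠ b 3 → Q (b 4) = b 4 →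
      ∃ N₁ N₂ N₃ : Equiv.Perm V, (∀ i, List.Perm [N₁ i, N₂ i, N₃ i, Q i] [σB i, σC i, σC i, σZ i]) ∧
        9 ≤ ∑ i, g i (N₃ i) ∧ 19 ≤ (∑ i, g i (N₂ i)) + ∑ i, g i (N₃ i))
    (hPC_BE : ∀ Q : Equiv.Perm V, (∀ i, Q i = σB i ∨ Q i = σE i ∨ Q i = σZ i) →
      Q (b 0) ≠ b 0 → Q (b 1) ≠ b 1 → Q (b 2) = b 2 → Q (b 3) ≠ b 3 → Q (b 4) = b 4 →
      ∃ N₁ N₂ N₃ : Equiv.Perm V, (∀ i, List.Perm [N₁ i, N₂ i, N₃ i, Q i] [σB i, σE i, σE i, σZ i]) ∧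
        9 ≤ ∑ i, g i (N₃ i) ∧ 21 ≤ (∑ i, g i (N₂ i)) + ∑ i, g i (N₃ i)) : False := by
  obtain ⟨hBC, hCE, hEZ⟩ := theta_order ok w g b hb hoff hmark haux hB hC hE hZ hB0 hB1 hB2 hB3 hB4 hC0 hC1 hC2 hC3 hC4
    hE0 hE1 hE2 hE3 hE4 hZ0 hZ1 hZ2 hZ3 hZ4
  rcases core_S3 ok w g b hb hoff hmark haux hB hC hE hZ hB0 hB1 hB2 hB3 hB4 hC0 hC1 hC2 hC3 hC4 hE0 hE1 hE2 hE3 hE4 hZ0 hZ1 hZ2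
      hZ3 hZ4 with ⟨Q, hQ, h0, h1, h2, h3, h4⟩ | ⟨Q, hQ, h0, h1, h2, h3, h4⟩
  · obtain ⟨N₁, N₂, N₃, hP, h9, h19⟩ := hPC_BC Q hQ h0 h1 h2 h3 h4
    exact law_of_pcD_BC ok w g b hb hoff hmark haux hBC (hCE.trans hEZ) hB hC hZ hB0 hB1 hB2 hB3 hB4 hC0 hC1 hC2 hC3 hC4 hZ0 hZ1
      hZ2 hZ3 hZ4 hP h0 h1 h4 h9 h19
  · obtain ⟨N₁, N₂, N₃, hP, h9, h21⟩ := hPC_BE Q hQ h0 h1 h2 h3 h4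
    exact law_of_pcD_BE ok w g b hb hoff hmark haux (hBC.trans hCE) hEZ hB hE hZ hB0 hB1 hB2 hB3 hB4 hE0 hE1 hE2 hE3 hE4 hZ0
      hZ1 hZ2 hZ3 hZ4 hP h0 h2 h4 h9 h21

end Core

end Core
end MarkedEdge
end Summit.ValiantsHypothesis.ValiantsHypothesis.Theorems.KPlusLogSqLaw
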